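import Summits.BirchSwinnertonDyer.BirchSwinnertonDyer.Theses.PrintCf2
import Summits.BirchSwinnertonDyer.BirchSwinnertonDyer.Theorems.PrintCf2SplitBadEisensteinTwoDivisibilitiesHalfDescentClass
import Summits.BirchSwinnertonDyer.BirchSwinnertonDyer.Theorems.PrintCf2SplitBadEisensteinTwoBdpComposition
import HarnessLib

/-!
# Child crux `PrintCf2.SplitBadTwoLowerHalfOfFacts` (stmt-BirchSwinnertonDyer-27851) — the MIRRORED BRIDGE from the finite-level EISENSTEIN
# BOUND AT `2` (index currency) to the Eisenstein half of `BSD₂` on the split-bad CM rank-one class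

Width seat `bsd-line-cf2-p1-w3` g2 of cell `bsd-print-cf2` (`--supports stmt-BirchSwinnertonDyer-27851`, helper). Twin of
`PrintCf2SplitBadTwoUpperHalfOfFactsKolyvaginBoundBridge.lean` (p638806) for the LOWER half, answering planner g15's question (13:19:18Z (5))
«if the pro-dihedral obstruction bites D = stub_lowerDivisibility_two, the mirrored re-cut is `stub_eisensteinBoundAtTwo` = the conclusion of
`sha_add_tamagawa_ge_of_lowerDivisibility_two`»: it does bite (D is the «L ∣ char» half of the same Hida–Tilouine main conjecture for the quartic
CM field `K·ℚ(√−7)`, memo STUB-U-analysis-w3g2 §2 F2 — printed for odd `p` only), and this file is the bridge for that re-cut: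
  `(EB)_W`: on every Heegner frame `(N, K, Dt, H, ι, P)` of `W` with `d_K < −4`, `P` non-torsion, `Ш(E/K)` finite:
           `2·ord₂ [E(K) : ℤP] − 2·ord₂ c_Manin ≤ ord₂ #Ш(E/K)[2^∞] + ord₂ ∏_w c_w(E/K)`
(the index-currency LOWER bound at `T = 0`, i.e. the Eisenstein half of `BSD₂(E/K)` since `#Ш_an(E/K) = 4I²/(c²w²c_K)`). THEOREMS ONLY
(0 definitions, 0 named facts, 0 `sorry`); CONDITIONAL on every displayed hypothesis. BSD is proved for no curve by any of this; no summit
statement is proved by this seat.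

* §1 (B1⁻) `lowerOverK_of_eisensteinBound_two` — ONE frame: `(EB)` at the frame + GZ/Kolyvagin/modularity ⟹ `∃ q′, #Ш_an(E_K) = q′ ∧ ord₂ q′ ≤ ord₂ #Ш(E_K)`.
* §2 (B2⁻) `missingLowerBoundAt_two_of_eisensteinBound_of_twist` — ONE `W` with `r_an(W) = 1`: toric prints + Milne + `(EB)_W` + twin `BSD₂` ⟹
  `MissingLowerBoundAt W 2`.
* §3 (B3⁻) `missingLowerBoundAt_two_of_eisensteinBound` — CLASS-WIDE from the stub text `stub_eisensteinBoundAtTwo` (= `(EB)` on the class, the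
  binder `hEB` below VERBATIM), twin from Burungale–Flach.
* §4 `splitBadTwoLowerHalfOfFacts_of_eisensteinBound` — the child BY NAME from {`ToricPublishedInputs`, Milne any-model} + the stub text (conditional).

References: [JetchevSkinnerWan2017] §7.4.1 (shape); [GrossZagier1986] I.6.3, V.(2.2); [Milne1972ArithmeticAV] §1 Thm. 1; [FriedbergHoffstein1995] Thm. B;
[BurungaleFlach2024] Cor. 2; [Miller2011LMS] Def. 1.1.
-/

set_option autoImplicit false

-- D-0017 layout: summit = sub-problem, so `Summit.BirchSwinnertonDyer.BirchSwinnertonDyer.…` is the mandated namespace of Theorems files.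
set_option linter.dupNamespace false

noncomputable section

open scoped Classical MatrixGroups ModularForm Topology NumberField

namespace Summit.BirchSwinnertonDyer.BirchSwinnertonDyer.Theorems.PrintCf2.EisensteinTwo

open Filter CongruenceSubgroup WeierstrassCurve NumberField IsDedekindDomain Field PowerSeries
  Literature.NumberTheory.EllipticCurves Literature.NumberTheory.EllipticCurves.ModularForms
  Literature.NumberTheory.EllipticCurves.LiuZhangZhang2018 Literature.NumberTheory.EllipticCurves.Rank1Residual
  Literature.NumberTheory.EllipticCurves.Rank1Residual.Typed Literature.NumberTheory.EllipticCurves.KrizLi2019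
  Literature.NumberTheory.GaloisRepresentations Literature.NumberTheory.GaloisCohomology
  Summit.BirchSwinnertonDyer.Rank1Residual Summit.BirchSwinnertonDyer.Rank1Residual.X11b
  Summit.BirchSwinnertonDyer.Rank1Residual.X11b.AcSelmer Summit.BirchSwinnertonDyer.Rank1Residual.X11b.CongruenceLimit
  Summit.BirchSwinnertonDyer.Rank1Residual.X11b.Halves Summit.BirchSwinnertonDyer.Rank1Residual.X2
  Summit.BirchSwinnertonDyer.Rank1Residual.Additive Summit.BirchSwinnertonDyer.Rank1Residual.AdditivePotMult
  Summit.BirchSwinnertonDyer.BirchSwinnertonDyer.Theses.UniversalToricDescent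
  Summit.BirchSwinnertonDyer.BirchSwinnertonDyer.Theorems.UniversalToricDescentWaldspurgerFlat

/-! ### §1 (B1⁻) One frame: the index-currency Eisenstein bound ⟹ the `K`-side lower half -/

/-- **(B1⁻) THE INDEX-CURRENCY EISENSTEIN BOUND AT ONE HEEGNER FRAME ⟹ `ord₂ #Ш_an(E_K) ≤ ord₂ #Ш(E_K)`** with `#Ш_an(E_K) = 4I²/(c²w²c_K)`
rational (`P2.shaAnOver_baseChange_eq_heegnerIndex_sq`, Gross–Zagier + Kolyvagin + modularity; `w_K = 2` from `d_K < −4`). The hypothesis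
`hbound` is the mirrored (lower) index bound at the frame `(N, K, Dt, H, ι, P)` — the conclusion of `sha_add_tamagawa_ge_of_lowerDivisibility_two`
(p630199) read as a hypothesis; no `Λ`, no frame series, no control socket. `ord₂(4I²/(c²·4·c_K)) = 2·ord₂ I − 2·ord₂ c − ord₂ c_K ≤ ord₂ #Ш(E_K)`.
CONDITIONAL on `hGZ`, `hKo`, `hmod`. [cite: GrossZagier1986, Thm. I.6.3 and V.(2.2)] [cite: JetchevSkinnerWan2017, §7.4.1 (shape)] -/
theorem lowerOverK_of_eisensteinBound_two
    (hmod : hasEntireLFunction_rat)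
    (W : WeierstrassCurve ℚ) [W.IsElliptic] [W.IsGloballyMinimal]
    (K : Type) [Field K] [NumberField K] {N : ℕ} [NeZero N]
    (Dt : ModularParametrizationData W N) (H : HeegnerDatum N (NumberField.discr K))
    (ιK : K →+* ℂ) (P : (W.baseChange K).toAffine.Point)
    (hGZ : gross_zagier N W K) (hKo : kolyvagin N W K)
    (hK : IsImaginaryQuadratic K) (hd4 : NumberField.discr K < -4) (hHN : SatisfiesHeegnerHypothesis N K)
    (hP : WeierstrassCurve.Affine.Point.map ιK.toRatAlgHom P = heegnerPointComplex Dt H)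
    (hPinf : ¬ IsOfFinAddOrder P) (hrk : (W.baseChange K).mordellWeilRank = 1) (hrK : (W.baseChange K).analyticRank = 1)
    (hbound : 2 * (padicValNat 2 (AddSubgroup.zmultiples P).index : ℤ) - 2 * (padicValNat 2 Dt.c.natAbs : ℤ) ≤
      (padicValNat 2 (Nat.card (AddCommGroup.primaryComponent (W.baseChange K).sha 2)) : ℤ) +
        (padicValNat 2 (W.baseChange K).tamagawaProduct : ℤ)) :
    ∃ q' : ℚ, shaAnOver (W.baseChange K) = (q' : ℂ) ∧
      padicValRat 2 q' ≤ (padicValNat 2 (W.baseChange K).shaOrder : ℤ) := by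
  have hc0 : Dt.c ≠ 0 := Dt.maninConstant_ne_zero_holds
  obtain ⟨-, hShaK, hval⟩ := Summit.BirchSwinnertonDyer.Rank1Residual.P2.shaAnOver_baseChange_eq_heegnerIndex_sq W N K Dt H ιK P
    hGZ hKo hmod hK hHN hP hc0 hrK
  haveI : Finite (W.baseChange K).sha := hShaK
  refine ⟨_, hval, ?_⟩
  -- `ord₂ (4 I²/(c² w² c_K)) = 2 + 2·ord₂ I − (2·ord₂ c + 2 + ord₂ c_K)` with `w_K = 2`
  set I : ℕ := (AddSubgroup.zmultiples P).index with hI_def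
  have hw2 : Units.torsionOrder K = 2 :=
    Literature.NumberTheory.QuadraticFields.Quadratic.torsionOrder_eq_two_of_discr_lt_neg_four hK.1 hd4
  have hheight := Summit.BirchSwinnertonDyer.Rank1Residual.P2.torsionOrder_sq_mul_canonicalHeight_eq_index_sq_mul_regulator
    (W.baseChange K) hrk P hPinf
  have htK : 0 < (W.baseChange K).torsionOrder := (W.baseChange K).torsionOrder_pos_holds
  have hI0 : I ≠ 0 := by
    intro hI
    rw [← hI_def, hI] at hheight
    have h0 : ((W.baseChange K).torsionOrder : ℝ) ^ 2 * P.canonicalHeight = 0 := by rw [hheight]; simp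
    rcases mul_eq_zero.mp h0 with h' | h'
    · exact absurd ((pow_eq_zero_iff two_ne_zero).mp h') (by exact_mod_cast htK.ne')
    · exact hPinf ((Affine.Point.canonicalHeight_eq_zero_iff_holds P).mp h')
  have hcK : 0 < (W.baseChange K).tamagawaProduct := (W.baseChange K).tamagawaProduct_pos_holds
  have hIQ : (I : ℚ) ≠ 0 := by exact_mod_cast hI0
  have hcQ : (Dt.c : ℚ) ≠ 0 := by exact_mod_cast hc0
  have hwQ : (Units.torsionOrder K : ℚ) ≠ 0 := by rw [hw2]; norm_num
  have hcKQ : ((W.baseChange K).tamagawaProduct : ℚ) ≠ 0 := by exact_mod_cast hcK.ne'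
  have hsha : padicValNat 2 (Nat.card (AddCommGroup.primaryComponent (W.baseChange K).sha 2)) =
      padicValNat 2 (W.baseChange K).shaOrder :=
    Literature.NumberTheory.EllipticCurves.padicValNat_card_addPrimaryComponent 2
  have hcval : padicValRat 2 (Dt.c : ℚ) = (padicValNat 2 Dt.c.natAbs : ℤ) := by
    rw [padicValRat.of_int]; rfl
  have h2val : padicValRat 2 (((2 : ℕ) : ℚ)) = 1 := by
    rw [padicValRat.of_nat, padicValNat_self]; rfl
  have h4val : padicValRat 2 (4 : ℚ) = 2 := by
    rw [show (4 : ℚ) = ((2 : ℕ) : ℚ) ^ 2 by norm_num, padicValRat.pow, h2val]; norm_num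
  have hLHS : padicValRat 2 (4 * (I : ℚ) ^ 2 / ((Dt.c : ℚ) ^ 2 * (Units.torsionOrder K : ℚ) ^ 2 *
      ((W.baseChange K).tamagawaProduct : ℚ))) =
      2 + 2 * (padicValNat 2 I : ℤ) - (2 * (padicValNat 2 Dt.c.natAbs : ℤ) + 2 * 1 +
        (padicValNat 2 (W.baseChange K).tamagawaProduct : ℤ)) := by
    rw [padicValRat.div (mul_ne_zero (by norm_num) (pow_ne_zero 2 hIQ))
        (mul_ne_zero (mul_ne_zero (pow_ne_zero 2 hcQ) (pow_ne_zero 2 hwQ)) hcKQ),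
      padicValRat.mul (by norm_num) (pow_ne_zero 2 hIQ), padicValRat.mul (mul_ne_zero (pow_ne_zero 2 hcQ) (pow_ne_zero 2 hwQ)) hcKQ,
      padicValRat.mul (pow_ne_zero 2 hcQ) (pow_ne_zero 2 hwQ), padicValRat.pow, padicValRat.pow, padicValRat.pow, h4val, hw2, hcval,
      h2val, padicValRat.of_nat, padicValRat.of_nat]
    push_cast
    ring
  rw [hLHS, ← hsha]
  linarith

/-! ### §2 (B2⁻) One `W`: the Eisenstein index bound on its Heegner frames ⟹ the Eisenstein half of `BSD₂(W)` -/

/-- **(B2⁻) THE EISENSTEIN HALF OF `BSD₂(W)` FROM THE FINITE-LEVEL EISENSTEIN INDEX BOUND ALONE.** For ONE globally minimal `W/ℚ` with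
`r_an(W) = 1` (no CM, no conductor hypothesis), GIVEN the toric published inputs `hF` (GZ, Kolyvagin, GZK, modularity, Friedberg–Hoffstein Thm. B,
parity, Heegner-point existence are used), Milne on minimal models, the lower bound `(EB)_W` on every Heegner frame with `d_K < −4`, `P`
non-torsion, `Ш(E/K)` finite (`hEB`, the mirrored binder of the planner's `KolyvaginBoundAtTwoOnFrames W`), and the twin's `BSD₂` `hTw` — THEN
`MissingLowerBoundAt W 2` (`ord₂ #Ш_an(W) ≤ ord₂ #Ш(W)`). Route: parity ⟹ Friedberg–Hoffstein field `K` (modulus `6`, so `d_K < −4`) with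
`L(E^{d_K},1) ≠ 0` ⟹ Heegner point, non-torsion (GZ), rank one and `Ш(E/K)` finite (Kolyvagin) ⟹ `(EB)` at that frame ⟹ (B1⁻) ⟹ lead g7's
one-sided Milne descent `missingLowerBoundAt_of_lowerOver_of_bsdp_twist`. No frame, no `Λ`, no `ι′`, no socket.
[cite: JetchevSkinnerWan2017, §7.4.1 (shape)] [cite: Milne1972ArithmeticAV, §1 Thm. 1] [cite: GrossZagier1986, V.(2.2)] [cite: FriedbergHoffstein1995, Thm. B] -/
theorem missingLowerBoundAt_two_of_eisensteinBound_of_twist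
    (hF : ToricPublishedInputs) (hMilne : Milne1972.bsdQuotient_baseChange_quadratic)
    (W : WeierstrassCurve ℚ) [W.IsElliptic] [W.IsGloballyMinimal] (hr : W.analyticRank = 1)
    (hEB : ∀ (N : ℕ) [NeZero N] (K : Type) [Field K] [NumberField K] (Dt : ModularParametrizationData W N)
      (H : HeegnerDatum N (NumberField.discr K)) (ι : K →+* ℂ) (P : (W.baseChange K).toAffine.Point),
      W.conductorNorm ℤ = N → IsImaginaryQuadratic K → SatisfiesHeegnerHypothesis N K → NumberField.discr K < -4 →
      WeierstrassCurve.Affine.Point.map ι.toRatAlgHom P = heegnerPointComplex Dt H → ¬ IsOfFinAddOrder P →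
      Finite (W.baseChange K).sha →
      2 * (padicValNat 2 (AddSubgroup.zmultiples P).index : ℤ) - 2 * (padicValNat 2 Dt.c.natAbs : ℤ) ≤
        (padicValNat 2 (Nat.card (AddCommGroup.primaryComponent (W.baseChange K).sha 2)) : ℤ) +
          (padicValNat 2 (W.baseChange K).tamagawaProduct : ℤ))
    (hTw : ∀ (N : ℕ) [NeZero N] (K : Type) [Field K] [NumberField K]
      (Wd : WeierstrassCurve ℚ) [Wd.IsElliptic] [Wd.IsGloballyMinimal],
      W.conductorNorm ℤ = N → IsImaginaryQuadratic K → SatisfiesHeegnerHypothesis N K →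
      (∃ C : VariableChange ℚ, C • W.quadraticTwist (NumberField.discr K : ℚ) = Wd) →
      (W.quadraticTwist (NumberField.discr K : ℚ)).entireLFunction 1 ≠ 0 → BSDp Wd 2) :
    MissingLowerBoundAt W 2 := by
  obtain ⟨hGZ, hKo, hGZK, hmod, hmodP, -, hGZ73, hFH, hpar, hHP⟩ := hF
  haveI hN0 : NeZero (W.conductorNorm ℤ) := ⟨W.conductorNorm_pos_holds.ne'⟩
  ------------------------------------------------------------------ parity and the Friedberg–Hoffstein field (modulus `6`)
  have hw : W.rootNumber = -1 := by
    rcases W.rootNumber_eq_one_or with h | h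
    · exfalso
      have heven : Even W.analyticRank := (hpar W).mpr h
      rw [hr] at heven
      exact Nat.not_even_one heven
    · exact h
  obtain ⟨K, _, _, hK, -, hHN, hH6, hLt⟩ := hFH W hw 6 (by norm_num) 0
  have hd4 : NumberField.discr K < -4 :=
    discr_lt_neg_four_of_three_split hK (hH6 3 Nat.prime_three (by norm_num : (3 : ℕ) ∣ 6))
  ------------------------------------------------------------------ the Heegner point, non-torsion, Kolyvagin
  obtain ⟨P, Dt, H, ι, hP⟩ := hHP W K hK hHN
  have hL0 : W.entireLFunction 1 = 0 := entireLFunction_one_eq_zero_of_analyticRank_eq_one hr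
  obtain ⟨-, hderiv⟩ := leadingLCoeff_eq_deriv_of_analyticRank_eq_one hr
  have hLK : LDerivEK W K ≠ 0 := by
    rw [lDerivEK_eq_deriv_mul W K hmod hL0]; exact mul_ne_zero hderiv hLt
  have hnt : ¬ IsOfFinAddOrder P :=
    (lDerivEK_ne_zero_iff_not_isOfFinAddOrder W (W.conductorNorm ℤ) K (hGZ _ W K) hK hHN ⟨Dt, H, ι, hP⟩).mp hLK
  have hKoK : Literature.NumberTheory.EllipticCurves.kolyvagin (W.conductorNorm ℤ) W K := hKo _ W K
  obtain ⟨hrk, hfinK⟩ := hKoK hK hHN ⟨Dt, H, ι, hP⟩ hnt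
  ------------------------------------------------------------------ the finite-level bound at this frame
  have hbound := hEB (W.conductorNorm ℤ) K Dt H ι P rfl hK hHN hd4 hP hnt hfinK
  ------------------------------------------------------------------ ranks of the pair and the twin
  have h2 : Module.finrank ℚ K = 2 := hK.1
  haveI : (W.baseChange K).IsGloballyMinimal := W.isGloballyMinimal_baseChange_of_satisfiesHeegnerHypothesis K h2 hHN
  have hD0 : (NumberField.discr K : ℚ) ≠ 0 := by exact_mod_cast NumberField.discr_ne_zero K
  haveI hEt : (W.quadraticTwist (NumberField.discr K : ℚ)).IsElliptic := W.isElliptic_quadraticTwist hD0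
  have hrd0 : (W.quadraticTwist (NumberField.discr K : ℚ)).analyticRank = 0 :=
    ((W.quadraticTwist (NumberField.discr K : ℚ)).analyticRank_eq_zero_iff_holds (hmod _)).mpr hLt
  have hrK : (W.baseChange K).analyticRank = 1 :=
    (Summit.BirchSwinnertonDyer.Rank1Residual.P2.analyticRank_baseChange_eq_one_iff W K hmod h2).mpr (Or.inl ⟨hr, hrd0⟩)
  obtain ⟨Cd, hCd⟩ := hasGlobalMinimalModel_rat_holds (W.quadraticTwist (NumberField.discr K : ℚ))
  haveI : (Cd • W.quadraticTwist (NumberField.discr K : ℚ)).IsGloballyMinimal := hCd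
  have hWd : BSDp (Cd • W.quadraticTwist (NumberField.discr K : ℚ)) 2 :=
    hTw (W.conductorNorm ℤ) K (Cd • W.quadraticTwist (NumberField.discr K : ℚ)) rfl hK hHN ⟨Cd, rfl⟩ hLt
  have hrW : W.analyticRank ≤ 1 := by rw [hr]
  have hrd : (Cd • W.quadraticTwist (NumberField.discr K : ℚ)).analyticRank ≤ 1 := by
    rw [analyticRank_smul, hrd0]; exact zero_le_one
  ------------------------------------------------------------------ (B1⁻) and the one-sided descent
  have hKup := lowerOverK_of_eisensteinBound_two hmod W K Dt H ι P (hGZ _ W K) hKoK hK hd4 hHN hP hnt hrk hrK hbound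
  exact missingLowerBoundAt_of_lowerOver_of_bsdp_twist W 2 K (Cd • W.quadraticTwist (NumberField.discr K : ℚ)) (W.baseChange K)
    hGZK hmod hMilne hrW h2 ⟨Cd, rfl⟩ hrd ⟨1, one_smul _ _⟩ hKup hWd

/-! ### §3 (B3⁻) Class-wide: the mirrored stub text `stub_eisensteinBoundAtTwo` ⟹ the Eisenstein half on the class -/

/-- **(B3⁻) CLASS-WIDE: the finite-level Eisenstein index bound on the class (`hEB`, the mirrored twin of the planner's
`StubKolyvaginBoundAtTwo` = the proposed `stub_eisensteinBoundAtTwo`) gives the Eisenstein half of `BSD₂` on the split-bad CM rank-one class**,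
granted the toric prints, Milne on minimal models and — for the rank-zero twin — Burungale–Flach with modularity
(`rankZeroTwistBSDp_two_of_hasCM_of_print`). For `W` with `W.HasCM`, `r_an(W) = 1`, `CMSplit W 2`, `¬ Good W 2`: `MissingLowerBoundAt W 2`.
[cite: JetchevSkinnerWan2017, §7.4.1 (shape)] [cite: Milne1972ArithmeticAV, §1 Thm. 1] [cite: BurungaleFlach2024, Cor. 2 (the CM rank-zero twin)] -/
theorem missingLowerBoundAt_two_of_eisensteinBound
    (hF : ToricPublishedInputs) (hMilne : Milne1972.bsdQuotient_baseChange_quadratic)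
    (hBF : bsdTriple_of_hasCM_of_L_one_ne_zero) (hmod : hasEntireLFunction_rat)
    (hEB : ∀ (W : WeierstrassCurve ℚ) [W.IsElliptic] [W.IsGloballyMinimal],
      W.HasCM → W.analyticRank = 1 → CMSplit W 2 → ¬ Good W 2 →
      ∀ (N : ℕ) [NeZero N] (K : Type) [Field K] [NumberField K] (Dt : ModularParametrizationData W N)
        (H : HeegnerDatum N (NumberField.discr K)) (ι : K →+* ℂ) (P : (W.baseChange K).toAffine.Point),
        W.conductorNorm ℤ = N → IsImaginaryQuadratic K → SatisfiesHeegnerHypothesis N K → NumberField.discr K < -4 →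
        WeierstrassCurve.Affine.Point.map ι.toRatAlgHom P = heegnerPointComplex Dt H → ¬ IsOfFinAddOrder P →
        Finite (W.baseChange K).sha →
        2 * (padicValNat 2 (AddSubgroup.zmultiples P).index : ℤ) - 2 * (padicValNat 2 Dt.c.natAbs : ℤ) ≤
          (padicValNat 2 (Nat.card (AddCommGroup.primaryComponent (W.baseChange K).sha 2)) : ℤ) +
            (padicValNat 2 (W.baseChange K).tamagawaProduct : ℤ)) :
    ∀ (W : WeierstrassCurve ℚ) [W.IsElliptic] [W.IsGloballyMinimal],
      W.HasCM → W.analyticRank = 1 → CMSplit W 2 → ¬ Good W 2 → MissingLowerBoundAt W 2 := by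
  intro W _ _ hCM hr hsplit hng
  exact missingLowerBoundAt_two_of_eisensteinBound_of_twist hF hMilne W hr (hEB W hCM hr hsplit hng)
    (rankZeroTwistBSDp_two_of_hasCM_of_print hBF hmod W hCM)

/-! ### §4 The child 27851 BY NAME from the mirrored stub text (conditional) -/

/-- **`PrintCf2.SplitBadTwoLowerHalfOfFacts` (stmt-BirchSwinnertonDyer-27851) FROM THE FINITE-LEVEL EISENSTEIN INDEX BOUND** and the two
prints of the kside line (`ToricPublishedInputs`, Milne 1972 any-model = items 20389 / 24149), Burungale–Flach and modularity coming from the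
child's own bundle `𝔅_split`. CONDITIONAL on `hPr` and on the research statement `hEB` (the proposed `stub_eisensteinBoundAtTwo`); a
composition, credits nothing. [cite: JetchevSkinnerWan2017, §7.4.1 (shape)] [cite: Milne1972ArithmeticAV, §1 Thm. 1] -/
theorem splitBadTwoLowerHalfOfFacts_of_eisensteinBound
    (hPr : ToricPublishedInputs ∧ Milne1972.bsdQuotient_baseChange_quadratic_anyModel)
    (hEB : ∀ (W : WeierstrassCurve ℚ) [W.IsElliptic] [W.IsGloballyMinimal],
      W.HasCM → W.analyticRank = 1 → CMSplit W 2 → ¬ Good W 2 →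
      ∀ (N : ℕ) [NeZero N] (K : Type) [Field K] [NumberField K] (Dt : ModularParametrizationData W N)
        (H : HeegnerDatum N (NumberField.discr K)) (ι : K →+* ℂ) (P : (W.baseChange K).toAffine.Point),
        W.conductorNorm ℤ = N → IsImaginaryQuadratic K → SatisfiesHeegnerHypothesis N K → NumberField.discr K < -4 →
        WeierstrassCurve.Affine.Point.map ι.toRatAlgHom P = heegnerPointComplex Dt H → ¬ IsOfFinAddOrder P →
        Finite (W.baseChange K).sha →
        2 * (padicValNat 2 (AddSubgroup.zmultiples P).index : ℤ) - 2 * (padicValNat 2 Dt.c.natAbs : ℤ) ≤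
          (padicValNat 2 (Nat.card (AddCommGroup.primaryComponent (W.baseChange K).sha 2)) : ℤ) +
            (padicValNat 2 (W.baseChange K).tamagawaProduct : ℤ)) :
    Summit.BirchSwinnertonDyer.BirchSwinnertonDyer.Theses.PrintCf2.SplitBadTwoLowerHalfOfFacts := by
  intro hB W _ _ hCM hr hsplit hng
  exact missingLowerBoundAt_two_of_eisensteinBound hPr.1 (Milne1972.bsdQuotient_baseChange_quadratic_of_anyModel hPr.2)
    hB.2.2.2.1 hB.2.1 hEB W hCM hr hsplit hng

end Summit.BirchSwinnertonDyer.BirchSwinnertonDyer.Theorems.PrintCf2.EisensteinTwo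

end
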